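import Literature.MathematicalPhysics.QuantumFieldTheory.OSSkeletonClusters
import HarnessLib

/-!
# Skeleton clusters at vector positions and their Euclidean frames (OS II, Ch. V, Method B bookkeeping)

Topic `Literature/MathematicalPhysics/QuantumFieldTheory`; sequel of `OSSkeletonClusters`, where the
points of a tensor cluster `⊗ⱼ φⱼ` were moved along the time axis only (`skeletonFn Φ₀ a`, times
`a`). Osterwalder–Schrader II (Comm. Math. Phys. 42 (1975)), Ch. V.1, "Method B": real
analyticity in *all* variables uses configurations `ξ + ∑ u_i^μ e_μ` displaced in `d` linearly
independent directions `e_μ` and, for each `μ`, a Euclidean frame in which `e_μ` is the time axis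
((5.5)–(5.7)). This file provides the corresponding bookkeeping:

* `skeletonFnV Φ₀ p` — the cluster `Φ₀(x₀ - p₀, …, x_{K-1} - p_{K-1})` at **vector positions**
  `p : Fin K → ℝᵈ` (`skeletonFn Φ₀ a = skeletonFnV Φ₀ (timeShift a)`), its continuity and
  polynomial seminorm growth in `p`, translation, splitting of tensor clusters, OS adjoint
  (`osAdjoint_skeletonFnV_tensorFin`: reflected profiles at time-reflected, reversed positions),
  positivity in time;
* the generators `leftGenFnV`, `rightGenFnV` of a split cluster and the **pairing identity**
  `𝔖_{n+m}(⊗ⱼ φⱼ(· - pⱼ)) = genPairing P (shiftGen t R)` when the first `n` positions have times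
  `< -r` and the last `m` times `> r + t` (`schwinger_skeletonFnV_eq_genPairing`, OS II (5.4));
* **frames**: `rotOne L ψ = ψ ∘ L⁻¹` and
  `linActMulti L (skeletonFnV (⊗ψⱼ) p) = skeletonFnV (⊗ (rotOne L ψⱼ)) (L ∘ p)`
  (`linActMulti_skeletonFnV_tensorFin`), so that by Euclidean covariance (E1)
  `𝔖 (skeletonFnV (⊗ψⱼ) p) = 𝔖 (skeletonFnV (⊗ rotOne L ψⱼ) (L ∘ p))`
  (`schwinger_skeletonFnV_frame`); ball supports of the profiles are frame independent
  (`tsupport_rotOne_subset`, `slab_of_ball`).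

## References

* K. Osterwalder, R. Schrader, *Axioms for Euclidean Green's functions II*, Comm. Math. Phys.
  42 (1975) 281–305, Ch. V (5.4)–(5.7). [OsterwalderSchraderCMP1975]
-/

noncomputable section

open MeasureTheory Set Filter
open _root_.Topology
open scoped InnerProductSpace NNReal ComplexConjugate SchwartzMap

namespace Literature.MathematicalPhysics.QuantumFieldTheory

variable {d : ℕ}

open Literature.MathematicalPhysics.QuantumLattice (SchwingerFamily IsPositiveTimeMulti)
open Literature.MathematicalPhysics.QuantumLattice.SchwingerFamily

section General

/-! ### Skeleton clusters at vector positions -/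

/-- The **skeleton cluster at vector positions** `Φ₀(x₀ - p₀, …, x_{K-1} - p_{K-1})`. [folklore] -/
def skeletonFnV {K : ℕ} (Φ₀ : 𝓢((Fin K → EuclideanSpace ℝ (Fin d)), ℂ))
    (p : Fin K → EuclideanSpace ℝ (Fin d)) : 𝓢((Fin K → EuclideanSpace ℝ (Fin d)), ℂ) :=
  SchwartzMap.compSubConstCLM ℂ p Φ₀

/-- Values of a skeleton cluster at vector positions. [folklore] -/
@[simp] theorem skeletonFnV_apply {K : ℕ} (Φ₀ : 𝓢((Fin K → EuclideanSpace ℝ (Fin d)), ℂ))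
    (p : Fin K → EuclideanSpace ℝ (Fin d)) (x : Fin K → EuclideanSpace ℝ (Fin d)) :
    skeletonFnV Φ₀ p x = Φ₀ (fun j => x j - p j) := rfl

/-- **Continuity in the positions.** [folklore] -/
theorem continuous_skeletonFnV {K : ℕ} (Φ₀ : 𝓢((Fin K → EuclideanSpace ℝ (Fin d)), ℂ)) :
    Continuous (skeletonFnV Φ₀) :=
  QuantumLattice.continuous_compSubConstCLM (𝕜 := ℂ) Φ₀

/-- **Polynomial growth of the seminorms in the positions**:
`p_{k,n}(skeletonFnV Φ₀ p) ≤ 2ᵏ (1 + ‖p‖)ᵏ (p_{k,n}(Φ₀) + p_{0,n}(Φ₀))`. [folklore] -/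
theorem seminorm_skeletonFnV_le {K : ℕ} (Φ₀ : 𝓢((Fin K → EuclideanSpace ℝ (Fin d)), ℂ))
    (k n : ℕ) (p : Fin K → EuclideanSpace ℝ (Fin d)) :
    SchwartzMap.seminorm ℂ k n (skeletonFnV Φ₀ p) ≤
      2 ^ k * (1 + ‖p‖) ^ k * (SchwartzMap.seminorm ℂ k n Φ₀ + SchwartzMap.seminorm ℂ 0 n Φ₀) :=
  SchwartzMap.seminorm_compSubConstCLM_le Φ₀ k n _

/-- **Joint translation** of a cluster shifts all positions: `(skeletonFnV Φ₀ p)_c = skeletonFnV Φ₀ (p + c)`. [folklore] -/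
theorem translateMulti_skeletonFnV {K : ℕ} (Φ₀ : 𝓢((Fin K → EuclideanSpace ℝ (Fin d)), ℂ))
    (p : Fin K → EuclideanSpace ℝ (Fin d)) (c : EuclideanSpace ℝ (Fin d)) :
    QuantumLattice.translateMulti c (skeletonFnV Φ₀ p) = skeletonFnV Φ₀ (fun j => p j + c) := by
  ext x
  simp only [QuantumLattice.translateMulti_apply, skeletonFnV_apply]
  congr 1
  funext j
  abel

/-- **Splitting a cluster** over `n + m` points. [folklore] -/
theorem skeletonFnV_tensorFin_add {n m : ℕ} (φ : Fin (n + m) → 𝓢(EuclideanSpace ℝ (Fin d), ℂ))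
    (p : Fin (n + m) → EuclideanSpace ℝ (Fin d)) :
    skeletonFnV (SchwartzMap.tensorFin (n + m) φ) p =
      (skeletonFnV (SchwartzMap.tensorFin n fun j => φ (Fin.castAdd m j)) fun j => p (Fin.castAdd m j)).appendTensor
        (skeletonFnV (SchwartzMap.tensorFin m fun j => φ (Fin.natAdd n j)) fun j => p (Fin.natAdd n j)) := by
  ext x
  simp only [skeletonFnV_apply, SchwartzMap.tensorFin_apply, SchwartzMap.appendTensor_apply,
    Function.comp_apply]
  exact Fin.prod_univ_add _

/-- Transport along `n + m = K`. [folklore] -/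
theorem schwinger_skeletonFnV_tensorFin_cast (𝔖 : SchwingerFamily (EuclideanSpace ℝ (Fin d)))
    {K n m : ℕ} (h : n + m = K) (φ : Fin K → 𝓢(EuclideanSpace ℝ (Fin d), ℂ))
    (p : Fin K → EuclideanSpace ℝ (Fin d)) :
    𝔖 K (skeletonFnV (SchwartzMap.tensorFin K φ) p) =
      𝔖 (n + m) (skeletonFnV (SchwartzMap.tensorFin (n + m) fun j => φ (Fin.cast h j)) fun j => p (Fin.cast h j)) := by
  subst h
  rfl

/-- A one-point test function in the frame `L`: `rotOne L ψ = ψ ∘ L⁻¹`. [cite: OsterwalderSchraderCMP1975, Ch. V.1 eq. (5.5)] -/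
def rotOne (L : EuclideanSpace ℝ (Fin d) ≃ₗᵢ[ℝ] EuclideanSpace ℝ (Fin d)) (ψ : 𝓢(EuclideanSpace ℝ (Fin d), ℂ)) :
    𝓢(EuclideanSpace ℝ (Fin d), ℂ) :=
  SchwartzMap.compCLMOfContinuousLinearEquiv ℂ L.symm.toContinuousLinearEquiv ψ

/-- Values in the frame. [folklore] -/
@[simp] theorem rotOne_apply (L : EuclideanSpace ℝ (Fin d) ≃ₗᵢ[ℝ] EuclideanSpace ℝ (Fin d))
    (ψ : 𝓢(EuclideanSpace ℝ (Fin d), ℂ)) (y : EuclideanSpace ℝ (Fin d)) : rotOne L ψ y = ψ (L.symm y) := rfl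

/-- **A tensor cluster in a frame**: `linActMulti L (skeletonFnV (⊗ψⱼ) p) = skeletonFnV (⊗ rotOne L ψⱼ) (L ∘ p)`. [cite: OsterwalderSchraderCMP1975, Ch. V.1 eqs. (5.5)–(5.7)] -/
theorem linActMulti_skeletonFnV_tensorFin {K : ℕ} (L : EuclideanSpace ℝ (Fin d) ≃ₗᵢ[ℝ] EuclideanSpace ℝ (Fin d))
    (ψ : Fin K → 𝓢(EuclideanSpace ℝ (Fin d), ℂ)) (p : Fin K → EuclideanSpace ℝ (Fin d)) :
    QuantumLattice.linActMulti L (skeletonFnV (SchwartzMap.tensorFin K ψ) p) =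
      skeletonFnV (SchwartzMap.tensorFin K fun j => rotOne L (ψ j)) fun j => L (p j) := by
  ext x
  simp only [QuantumLattice.linActMulti_apply, skeletonFnV_apply, SchwartzMap.tensorFin_apply, rotOne_apply,
    map_sub, LinearIsometryEquiv.symm_apply_apply]

/-- **Euclidean covariance in a frame**: `𝔖 (⊗ψⱼ at p) = 𝔖 (⊗ rotOne L ψⱼ at L ∘ p)`. [cite: OsterwalderSchraderCMP1975, Ch. V.1 eq. (5.7)] -/
theorem schwinger_skeletonFnV_frame {𝔖 : SchwingerFamily (EuclideanSpace ℝ (Fin d))}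
    (hE1 : 𝔖.IsEuclideanCovariant) {K : ℕ} (L : EuclideanSpace ℝ (Fin d) ≃ₗᵢ[ℝ] EuclideanSpace ℝ (Fin d))
    (ψ : Fin K → 𝓢(EuclideanSpace ℝ (Fin d), ℂ)) (p : Fin K → EuclideanSpace ℝ (Fin d)) :
    𝔖 K (skeletonFnV (SchwartzMap.tensorFin K ψ) p) =
      𝔖 K (skeletonFnV (SchwartzMap.tensorFin K fun j => rotOne L (ψ j)) fun j => L (p j)) := by
  rw [← linActMulti_skeletonFnV_tensorFin, hE1.2 K L]

/-- **Ball supports are frame independent**: `tsupport ψ ⊆ closedBall 0 r` implies the same for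
`rotOne L ψ`. [folklore] -/
theorem tsupport_rotOne_subset {L : EuclideanSpace ℝ (Fin d) ≃ₗᵢ[ℝ] EuclideanSpace ℝ (Fin d)}
    {ψ : 𝓢(EuclideanSpace ℝ (Fin d), ℂ)} {r : ℝ}
    (hψ : tsupport (ψ : EuclideanSpace ℝ (Fin d) → ℂ) ⊆ Metric.closedBall 0 r) :
    tsupport (rotOne L ψ : EuclideanSpace ℝ (Fin d) → ℂ) ⊆ Metric.closedBall 0 r := by
  intro y hy
  have hfun : (rotOne L ψ : EuclideanSpace ℝ (Fin d) → ℂ) = (ψ : EuclideanSpace ℝ (Fin d) → ℂ) ∘ L.symm := by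
    funext z; rfl
  rw [hfun] at hy
  have h := hψ (tsupport_comp_subset_preimage (ψ : EuclideanSpace ℝ (Fin d) → ℂ) L.symm.continuous hy)
  simpa [Metric.mem_closedBall, dist_zero_right] using h

end General

section Time

variable [NeZero d]

/-- Time skeletons are vector skeletons at `timeShift a`. [folklore] -/
theorem skeletonFn_eq_skeletonFnV {K : ℕ} (Φ₀ : 𝓢((Fin K → EuclideanSpace ℝ (Fin d)), ℂ))
    (a : Fin K → ℝ) : skeletonFn Φ₀ a = skeletonFnV Φ₀ (timeShift a) := rfl

/-- **The OS adjoint of a tensor cluster at vector positions**: reversed order, reflected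
profiles, time-reflected positions. [folklore] -/
theorem osAdjoint_skeletonFnV_tensorFin {K : ℕ} (ψ : Fin K → 𝓢(EuclideanSpace ℝ (Fin d), ℂ))
    (p : Fin K → EuclideanSpace ℝ (Fin d)) :
    QuantumLattice.osAdjoint (skeletonFnV (SchwartzMap.tensorFin K ψ) p) =
      skeletonFnV (SchwartzMap.tensorFin K fun j => reflectOne (ψ (Fin.rev j)))
        fun j => QuantumLattice.timeReflection d (p (Fin.rev j)) := by
  ext x
  simp only [QuantumLattice.osAdjoint_apply, skeletonFnV_apply, SchwartzMap.tensorFin_apply, map_prod,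
    reflectOne_apply]
  rw [← Equiv.prod_comp Fin.revPerm (fun j => conj (ψ j (QuantumLattice.timeReflection d (x (Fin.rev j)) - p j)))]
  refine Finset.prod_congr rfl fun j _ => ?_
  simp only [Fin.revPerm_apply, Fin.rev_rev, map_sub]
  congr 2
  rw [QuantumLattice.timeReflection_timeReflection]

/-- **Positivity in time of a tensor cluster at vector positions**: profiles supported in
`{|y⁰| ≤ r}` and positions with times `> r`. [folklore] -/
theorem isPositiveTimeMulti_skeletonFnV_tensorFin {K : ℕ} {φ : Fin K → 𝓢(EuclideanSpace ℝ (Fin d), ℂ)}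
    {r : ℝ} (hφ : ∀ j, tsupport (φ j : EuclideanSpace ℝ (Fin d) → ℂ) ⊆ {y | |y 0| ≤ r})
    {p : Fin K → EuclideanSpace ℝ (Fin d)} (hp : ∀ j, r < p j 0) :
    IsPositiveTimeMulti (skeletonFnV (SchwartzMap.tensorFin K φ) p) := by
  intro x hx j
  have hcont : Continuous fun y : Fin K → EuclideanSpace ℝ (Fin d) => fun i => y i - p i := by fun_prop
  have hfun : (skeletonFnV (SchwartzMap.tensorFin K φ) p : (Fin K → EuclideanSpace ℝ (Fin d)) → ℂ) =
      (SchwartzMap.tensorFin K φ : (Fin K → EuclideanSpace ℝ (Fin d)) → ℂ) ∘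
        fun y : Fin K → EuclideanSpace ℝ (Fin d) => fun i => y i - p i := by
    funext y; rfl
  rw [hfun] at hx
  have hz := tsupport_comp_subset_preimage (SchwartzMap.tensorFin K φ : (Fin K → EuclideanSpace ℝ (Fin d)) → ℂ)
    hcont hx
  have hj := hφ j (apply_mem_tsupport_of_mem_tsupport_tensorFin φ hz j)
  simp only [mem_setOf_eq, PiLp.sub_apply] at hj
  have h := hp j
  change 0 < x j 0
  rcases abs_le.1 hj with ⟨h1, -⟩
  linarith

/-! ### The generators of a split cluster and the pairing identity -/

/-- The **left generator** at vector positions: OS adjoint of the first `n` points. [folklore] -/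
def leftGenFnV {n m : ℕ} (φ : Fin (n + m) → 𝓢(EuclideanSpace ℝ (Fin d), ℂ))
    (p : Fin (n + m) → EuclideanSpace ℝ (Fin d)) : 𝓢((Fin n → EuclideanSpace ℝ (Fin d)), ℂ) :=
  QuantumLattice.osAdjoint (skeletonFnV (SchwartzMap.tensorFin n fun j => φ (Fin.castAdd m j))
    fun j => p (Fin.castAdd m j))

/-- The **right generator** at vector positions: the last `m` points pulled back in time by `t`. [folklore] -/
def rightGenFnV {n m : ℕ} (φ : Fin (n + m) → 𝓢(EuclideanSpace ℝ (Fin d), ℂ))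
    (p : Fin (n + m) → EuclideanSpace ℝ (Fin d)) (t : ℝ) : 𝓢((Fin m → EuclideanSpace ℝ (Fin d)), ℂ) :=
  skeletonFnV (SchwartzMap.tensorFin m fun j => φ (Fin.natAdd n j)) fun j => p (Fin.natAdd n j) - timeVec t

/-- The left generator as a cluster of reflected profiles at reflected, reversed positions. [folklore] -/
theorem leftGenFnV_eq {n m : ℕ} (φ : Fin (n + m) → 𝓢(EuclideanSpace ℝ (Fin d), ℂ))
    (p : Fin (n + m) → EuclideanSpace ℝ (Fin d)) :
    leftGenFnV φ p = skeletonFnV (SchwartzMap.tensorFin n fun j => reflectOne (φ (Fin.castAdd m (Fin.rev j))))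
      fun j => QuantumLattice.timeReflection d (p (Fin.castAdd m (Fin.rev j))) := by
  rw [leftGenFnV, osAdjoint_skeletonFnV_tensorFin]

/-- **The left generator is positive-time** when the first `n` positions have times `< -r`. [folklore] -/
theorem isPositiveTimeMulti_leftGenFnV {n m : ℕ} {φ : Fin (n + m) → 𝓢(EuclideanSpace ℝ (Fin d), ℂ)}
    {r : ℝ} (hφ : ∀ j, tsupport (φ j : EuclideanSpace ℝ (Fin d) → ℂ) ⊆ {y | |y 0| ≤ r})
    {p : Fin (n + m) → EuclideanSpace ℝ (Fin d)} (hpL : ∀ j : Fin n, p (Fin.castAdd m j) 0 < -r) :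
    IsPositiveTimeMulti (leftGenFnV φ p) := by
  rw [leftGenFnV_eq]
  refine isPositiveTimeMulti_skeletonFnV_tensorFin (fun j => tsupport_reflectOne_subset (hφ _)) fun j => ?_
  have h := hpL (Fin.rev j)
  simp [QuantumLattice.timeReflection_apply]
  linarith

/-- **The right generator is positive-time** when the last `m` positions have times `> r + t`. [folklore] -/
theorem isPositiveTimeMulti_rightGenFnV {n m : ℕ} {φ : Fin (n + m) → 𝓢(EuclideanSpace ℝ (Fin d), ℂ)}
    {r : ℝ} (hφ : ∀ j, tsupport (φ j : EuclideanSpace ℝ (Fin d) → ℂ) ⊆ {y | |y 0| ≤ r})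
    {p : Fin (n + m) → EuclideanSpace ℝ (Fin d)} {t : ℝ} (hpR : ∀ j : Fin m, r + t < p (Fin.natAdd n j) 0) :
    IsPositiveTimeMulti (rightGenFnV φ p t) :=
  isPositiveTimeMulti_skeletonFnV_tensorFin (fun _ => hφ _) fun j => by
    have h := hpR j
    have h0 : (p (Fin.natAdd n j) - timeVec t : EuclideanSpace ℝ (Fin d)) 0 = p (Fin.natAdd n j) 0 - t := by
      simp [timeVec]
    rw [h0]
    linarith

/-- Translating the right generator forward by `t` restores the right sub-cluster. [folklore] -/
theorem translateMulti_rightGenFnV {n m : ℕ} (φ : Fin (n + m) → 𝓢(EuclideanSpace ℝ (Fin d), ℂ))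
    (p : Fin (n + m) → EuclideanSpace ℝ (Fin d)) (t : ℝ) :
    QuantumLattice.translateMulti (timeVec t) (rightGenFnV φ p t) =
      skeletonFnV (SchwartzMap.tensorFin m fun j => φ (Fin.natAdd n j)) fun j => p (Fin.natAdd n j) := by
  rw [rightGenFnV, translateMulti_skeletonFnV]
  congr 1
  funext j
  abel

/-- **The pairing identity for a split cluster at vector positions** (OS II (5.4)): first `n`
times `< -r`, last `m` times `> r + t`, `t ≥ 0`:
`𝔖_{n+m}(⊗ⱼ φⱼ(· - pⱼ)) = genPairing P (shiftGen t R)`. [cite: OsterwalderSchraderCMP1975, Ch. V eq. (5.4)] -/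
theorem schwinger_skeletonFnV_eq_genPairing (𝔖 : SchwingerFamily (EuclideanSpace ℝ (Fin d)))
    {n m : ℕ} {φ : Fin (n + m) → 𝓢(EuclideanSpace ℝ (Fin d), ℂ)} {r : ℝ}
    (hφ : ∀ j, tsupport (φ j : EuclideanSpace ℝ (Fin d) → ℂ) ⊆ {y | |y 0| ≤ r})
    {p : Fin (n + m) → EuclideanSpace ℝ (Fin d)} {t : ℝ} (ht : 0 ≤ t)
    (hpL : ∀ j : Fin n, p (Fin.castAdd m j) 0 < -r) (hpR : ∀ j : Fin m, r + t < p (Fin.natAdd n j) 0) :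
    𝔖 (n + m) (skeletonFnV (SchwartzMap.tensorFin (n + m) φ) p) =
      genPairing 𝔖 (mkGen (leftGenFnV φ p) (isPositiveTimeMulti_leftGenFnV hφ hpL))
        (shiftGen t (mkGen (rightGenFnV φ p t) (isPositiveTimeMulti_rightGenFnV hφ hpR))) := by
  rw [shiftGen_of_nonneg ht, genPairing_eq]
  change _ = 𝔖.osPairing (leftGenFnV φ p) (QuantumLattice.translateMulti (timeVec t) (rightGenFnV φ p t))
  rw [SchwingerFamily.osPairing, translateMulti_rightGenFnV, leftGenFnV, QuantumLattice.osAdjoint_osAdjoint,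
    skeletonFnV_tensorFin_add]

/-! ### Frames -/

/-- A ball support is a time-slab support: `closedBall 0 r ⊆ {|y⁰| ≤ r}`. [folklore] -/
theorem slab_of_ball {ψ : 𝓢(EuclideanSpace ℝ (Fin d), ℂ)} {r : ℝ}
    (hψ : tsupport (ψ : EuclideanSpace ℝ (Fin d) → ℂ) ⊆ Metric.closedBall 0 r) :
    tsupport (ψ : EuclideanSpace ℝ (Fin d) → ℂ) ⊆ {y | |y 0| ≤ r} := by
  intro y hy
  have h := hψ hy
  rw [Metric.mem_closedBall, dist_zero_right] at h
  have h2 : |y 0| ≤ ‖y‖ := by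
    have := EuclideanSpace.norm_eq y
    rw [EuclideanSpace.norm_eq]
    refine Real.le_sqrt_of_sq_le ?_
    rw [← Real.norm_eq_abs, ← sq_abs, abs_norm]
    exact Finset.single_le_sum (f := fun i => ‖y i‖ ^ 2) (fun i _ => sq_nonneg _) (Finset.mem_univ 0)
  exact h2.trans h

/-- The reflected profile of a ball-supported profile is ball-supported. [folklore] -/
theorem tsupport_reflectOne_subset_ball {ψ : 𝓢(EuclideanSpace ℝ (Fin d), ℂ)} {r : ℝ}
    (hψ : tsupport (ψ : EuclideanSpace ℝ (Fin d) → ℂ) ⊆ Metric.closedBall 0 r) :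
    tsupport (reflectOne ψ : EuclideanSpace ℝ (Fin d) → ℂ) ⊆ Metric.closedBall 0 r := by
  intro y hy
  have hfun : (reflectOne ψ : EuclideanSpace ℝ (Fin d) → ℂ) =
      (fun c : ℂ => conj c) ∘ ((ψ : EuclideanSpace ℝ (Fin d) → ℂ) ∘ QuantumLattice.timeReflection d) := by
    funext z; simp [reflectOne_apply]
  rw [hfun] at hy
  have h1 : y ∈ tsupport ((ψ : EuclideanSpace ℝ (Fin d) → ℂ) ∘ QuantumLattice.timeReflection d) :=
    tsupport_comp_subset (map_zero _) _ hy
  have h2 := tsupport_comp_subset_preimage (ψ : EuclideanSpace ℝ (Fin d) → ℂ)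
    (QuantumLattice.timeReflection d).continuous h1
  have h3 : QuantumLattice.timeReflection d y ∈ Metric.closedBall 0 r := hψ h2
  rw [Metric.mem_closedBall, dist_zero_right, LinearIsometryEquiv.norm_map] at h3
  rwa [Metric.mem_closedBall, dist_zero_right]

end Time

end Literature.MathematicalPhysics.QuantumFieldTheory
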